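import Literature.Barriers.CriticalPhenomena.PlanarEdwardsModelDiffusiveVaradhanProofs
import Mathlib.MeasureTheory.Function.LpSeminorm.CompareExp
import HarnessLib

/-!
# The limit `l → ∞` of the covariance `Cov(T_l, T_k)` of the mollified self-intersection local times

Companion of `…PlanarEdwardsModelDiffusiveSILTLimitDensity` (the diagonal limit `Var(T_k)`); here
`k ≥ 1` is FIXED and `l → ∞`: `Φ_{l,k} = (1/(2π)²) c²/(A B_k (A B_k - c²))`, `A = a + 1/l`,
`B_k = b + 1/k` (`covDensity_eq`) increases (`covDensity_mono`) to
`Φ_{∞,k} = (1/(2π)²) c²/(a B_k (a B_k - c²))` EVERYWHERE (no singular set: `a B_k - c² ≥ a/k`,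
and `c = 0` when `a = 0`), the integrals stay `≤ 57`, so (Beppo Levi)

* `tendsto_covDensity_left`, `integrable_limCovDensity_left`, `tendsto_integral_covDensity_left`;
* `tendsto_covariance_mollifiedSILT_left` — `Cov(T_l, T_k) → ∫_{[0,1]⁴} Φ_{∞,k}` (`l → ∞`);
* `integral_mul_renormalisedSILT_eq` — for the `L²` limit `γ` of the centred `T_l` (Varadhan),
  `E[γ (T_k - E T_k)] = ∫_{[0,1]⁴} Φ_{∞,k}`.

This makes the target of the second-moment limit (α₂) behind
`Edwards2D.Stoll1989_invariance_of_secondMomentLimits` an explicit number for every `k ≥ 1`.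

## References

* J.-F. Le Gall, Sém. Probab. XIX, LNM 1123 (1985), §2; A. Stoll, Math. Scand. 64 (1989), §2.
-/

noncomputable section

open MeasureTheory ProbabilityTheory Real Filter Set Function Topology
open scoped NNReal ENNReal BigOperators

namespace Literature.Barriers.CriticalPhenomena

namespace Edwards2D

open Literature.Probability.Process

variable {k : ℕ} (hk : 1 ≤ k) (pq : (ℝ × ℝ) × (ℝ × ℝ))
include hk

/-- **Pointwise limit `Φ_{l,k} → Φ_{∞,k}`** (`l → ∞`, `k ≥ 1` fixed), everywhere. [folklore] -/
theorem tendsto_covDensity_left :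
    Tendsto (fun l : ℕ => covDensity l k pq) atTop (𝓝 (1 / (2 * π) ^ 2 *
        (incrCov pq.1.1.toNNReal pq.1.2.toNNReal pq.2.1.toNNReal pq.2.2.toNNReal ^ 2 /
          (|((pq.1.2.toNNReal : ℝ≥0) : ℝ) - pq.1.1.toNNReal| * (|((pq.2.2.toNNReal : ℝ≥0) : ℝ) - pq.2.1.toNNReal| + 1 / k) *
            (|((pq.1.2.toNNReal : ℝ≥0) : ℝ) - pq.1.1.toNNReal| * (|((pq.2.2.toNNReal : ℝ≥0) : ℝ) - pq.2.1.toNNReal| + 1 / k) -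
              incrCov pq.1.1.toNNReal pq.1.2.toNNReal pq.2.1.toNNReal pq.2.2.toNNReal ^ 2))))) := by
  set a := |((pq.1.2.toNNReal : ℝ≥0) : ℝ) - pq.1.1.toNNReal| with ha
  set b := |((pq.2.2.toNNReal : ℝ≥0) : ℝ) - pq.2.1.toNNReal| with hb
  set c := incrCov pq.1.1.toNNReal pq.1.2.toNNReal pq.2.1.toNNReal pq.2.2.toNNReal with hc
  have ha0 : 0 ≤ a := abs_nonneg _
  have hb0 : 0 ≤ b := abs_nonneg _
  have hk0 : (0 : ℝ) < 1 / k := by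
    have : (0 : ℝ) < k := by exact_mod_cast hk
    positivity
  by_cases hc0 : c = 0
  · simp only [hc0, ne_eq, OfNat.ofNat_ne_zero, not_false_eq_true, zero_pow, zero_div, mul_zero]
    refine tendsto_const_nhds.congr' ?_
    filter_upwards [eventually_ge_atTop 1] with l hl1
    rw [covDensity_eq l k pq hl1 hk, ← hc, hc0]
    simp
  -- `c ≠ 0`: then `a > 0` and the limit denominator is positive
  have hca : |c| ≤ a := abs_incrCov_le_left _ _ _ _
  have hapos : 0 < a := lt_of_lt_of_le (abs_pos.2 hc0) hca
  have hc2 : c ^ 2 ≤ a * b := sq_incrCov_le _ _ _ _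
  have hden_pos : 0 < a * (b + 1 / k) * (a * (b + 1 / k) - c ^ 2) := by
    have h1 : 0 < a * (b + 1 / k) := by positivity
    have h2 : 0 < a * (b + 1 / k) - c ^ 2 := by nlinarith
    exact mul_pos h1 h2
  have hl : Tendsto (fun l : ℕ => (1 : ℝ) / l) atTop (𝓝 0) := tendsto_one_div_atTop_nhds_zero_nat
  have hA : Tendsto (fun l : ℕ => a + 1 / (l : ℝ)) atTop (𝓝 a) := by
    simpa using tendsto_const_nhds.add hl
  have hAB := hA.mul (tendsto_const_nhds (x := b + 1 / k))
  have hden := hAB.mul (hAB.sub (tendsto_const_nhds (x := c ^ 2)))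
  have hlim := (tendsto_const_nhds (x := c ^ 2)).div hden hden_pos.ne'
  refine ((tendsto_const_nhds (x := 1 / (2 * π) ^ 2)).mul hlim).congr' ?_
  filter_upwards [eventually_ge_atTop 1] with l hl1
  rw [covDensity_eq l k pq hl1 hk]
  simp only [Pi.div_apply, ha, hb, hc]

omit hk in
/-- The `ℝ≥0∞`-valued densities `l ↦ Φ_{l,k}` increase and have integrals `≤ 57`. [folklore] -/
theorem lintegral_iSup_covDensity_left_le (k : ℕ) :
    ∫⁻ pq, (⨆ l : ℕ, ENNReal.ofReal (covDensity l k pq)) ∂(unitSq.prod unitSq) ≤ ENNReal.ofReal 57 := by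
  have hmeas : ∀ l, AEMeasurable (fun pq => ENNReal.ofReal (covDensity l k pq)) (unitSq.prod unitSq) :=
    fun l => (integrable_covDensity l k).aestronglyMeasurable.aemeasurable.ennreal_ofReal
  have hmono : ∀ pq, Monotone fun l : ℕ => ENNReal.ofReal (covDensity l k pq) := fun pq l l' hll' =>
    ENNReal.ofReal_le_ofReal (covDensity_mono hll' le_rfl pq)
  rw [lintegral_iSup' hmeas (ae_of_all _ hmono)]
  refine iSup_le fun l => ?_
  rw [← ofReal_integral_eq_lintegral_ofReal (integrable_covDensity l k)
    (ae_of_all _ (covDensity_nonneg l k))]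
  exact ENNReal.ofReal_le_ofReal (integral_covDensity_le l k)

omit pq in
/-- **`Φ_{∞,k}` is integrable on `[0,1]⁴`** (Beppo Levi, `∫ Φ_{∞,k} ≤ 57`). [folklore] -/
theorem integrable_limCovDensity_left :
    Integrable (fun pq : (ℝ × ℝ) × (ℝ × ℝ) => (1 / (2 * π) ^ 2 *
        (incrCov pq.1.1.toNNReal pq.1.2.toNNReal pq.2.1.toNNReal pq.2.2.toNNReal ^ 2 /
          (|((pq.1.2.toNNReal : ℝ≥0) : ℝ) - pq.1.1.toNNReal| * (|((pq.2.2.toNNReal : ℝ≥0) : ℝ) - pq.2.1.toNNReal| + 1 / k) *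
            (|((pq.1.2.toNNReal : ℝ≥0) : ℝ) - pq.1.1.toNNReal| * (|((pq.2.2.toNNReal : ℝ≥0) : ℝ) - pq.2.1.toNNReal| + 1 / k) -
              incrCov pq.1.1.toNNReal pq.1.2.toNNReal pq.2.1.toNNReal pq.2.2.toNNReal ^ 2))))) (unitSq.prod unitSq) := by
  have hae : ∀ pq, Tendsto (fun l : ℕ => covDensity l k pq) atTop (𝓝 (1 / (2 * π) ^ 2 *
        (incrCov pq.1.1.toNNReal pq.1.2.toNNReal pq.2.1.toNNReal pq.2.2.toNNReal ^ 2 /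
          (|((pq.1.2.toNNReal : ℝ≥0) : ℝ) - pq.1.1.toNNReal| * (|((pq.2.2.toNNReal : ℝ≥0) : ℝ) - pq.2.1.toNNReal| + 1 / k) *
            (|((pq.1.2.toNNReal : ℝ≥0) : ℝ) - pq.1.1.toNNReal| * (|((pq.2.2.toNNReal : ℝ≥0) : ℝ) - pq.2.1.toNNReal| + 1 / k) -
              incrCov pq.1.1.toNNReal pq.1.2.toNNReal pq.2.1.toNNReal pq.2.2.toNNReal ^ 2))))) :=
    fun pq => tendsto_covDensity_left hk pq
  refine ⟨aestronglyMeasurable_of_tendsto_ae atTop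
    (fun l => (integrable_covDensity l k).aestronglyMeasurable) (ae_of_all _ hae), ?_⟩
  have hmono : ∀ pq, Monotone fun l : ℕ => ENNReal.ofReal (covDensity l k pq) := fun pq l l' hll' =>
    ENNReal.ofReal_le_ofReal (covDensity_mono hll' le_rfl pq)
  have h1 : ∀ pq, ‖(1 / (2 * π) ^ 2 *
        (incrCov pq.1.1.toNNReal pq.1.2.toNNReal pq.2.1.toNNReal pq.2.2.toNNReal ^ 2 /
          (|((pq.1.2.toNNReal : ℝ≥0) : ℝ) - pq.1.1.toNNReal| * (|((pq.2.2.toNNReal : ℝ≥0) : ℝ) - pq.2.1.toNNReal| + 1 / k) *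
            (|((pq.1.2.toNNReal : ℝ≥0) : ℝ) - pq.1.1.toNNReal| * (|((pq.2.2.toNNReal : ℝ≥0) : ℝ) - pq.2.1.toNNReal| + 1 / k) -
              incrCov pq.1.1.toNNReal pq.1.2.toNNReal pq.2.1.toNNReal pq.2.2.toNNReal ^ 2))))‖ₑ = ⨆ l : ℕ, ENNReal.ofReal (covDensity l k pq) := by
    intro pq
    have hnn : 0 ≤ (1 / (2 * π) ^ 2 *
        (incrCov pq.1.1.toNNReal pq.1.2.toNNReal pq.2.1.toNNReal pq.2.2.toNNReal ^ 2 /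
          (|((pq.1.2.toNNReal : ℝ≥0) : ℝ) - pq.1.1.toNNReal| * (|((pq.2.2.toNNReal : ℝ≥0) : ℝ) - pq.2.1.toNNReal| + 1 / k) *
            (|((pq.1.2.toNNReal : ℝ≥0) : ℝ) - pq.1.1.toNNReal| * (|((pq.2.2.toNNReal : ℝ≥0) : ℝ) - pq.2.1.toNNReal| + 1 / k) -
              incrCov pq.1.1.toNNReal pq.1.2.toNNReal pq.2.1.toNNReal pq.2.2.toNNReal ^ 2)))) := ge_of_tendsto' (hae pq) fun l => covDensity_nonneg l k pq
    rw [Real.enorm_eq_ofReal hnn]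
    exact tendsto_nhds_unique ((ENNReal.continuous_ofReal.tendsto _).comp (hae pq))
      (tendsto_atTop_iSup (hmono pq))
  unfold HasFiniteIntegral
  simp_rw [h1]
  exact lt_of_le_of_lt (lintegral_iSup_covDensity_left_le k) ENNReal.ofReal_lt_top

omit pq in
/-- **`∫ Φ_{l,k} → ∫ Φ_{∞,k}`** as `l → ∞` (monotone convergence). [folklore] -/
theorem tendsto_integral_covDensity_left :
    Tendsto (fun l : ℕ => ∫ pq, covDensity l k pq ∂(unitSq.prod unitSq)) atTop
      (𝓝 (∫ pq, (1 / (2 * π) ^ 2 *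
        (incrCov pq.1.1.toNNReal pq.1.2.toNNReal pq.2.1.toNNReal pq.2.2.toNNReal ^ 2 /
          (|((pq.1.2.toNNReal : ℝ≥0) : ℝ) - pq.1.1.toNNReal| * (|((pq.2.2.toNNReal : ℝ≥0) : ℝ) - pq.2.1.toNNReal| + 1 / k) *
            (|((pq.1.2.toNNReal : ℝ≥0) : ℝ) - pq.1.1.toNNReal| * (|((pq.2.2.toNNReal : ℝ≥0) : ℝ) - pq.2.1.toNNReal| + 1 / k) -
              incrCov pq.1.1.toNNReal pq.1.2.toNNReal pq.2.1.toNNReal pq.2.2.toNNReal ^ 2)))) ∂(unitSq.prod unitSq))) :=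
  integral_tendsto_of_tendsto_of_monotone (fun l => integrable_covDensity l k)
    (integrable_limCovDensity_left hk) (ae_of_all _ fun pq _ _ h => covDensity_mono h le_rfl pq)
    (ae_of_all _ fun pq => tendsto_covDensity_left hk pq)

omit pq in
/-- **`Cov(T_l, T_k) → ∫_{[0,1]⁴} Φ_{∞,k}`** as `l → ∞`, for every planar Brownian motion.
[cite: LeGall1985, §2] -/
theorem tendsto_covariance_mollifiedSILT_left {Ω : Type*} [MeasurableSpace Ω] {P : Measure Ω}
    [IsProbabilityMeasure P] {Z : ℝ≥0 → Ω → ℂ} (hZ : IsBrownianComplex Z P)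
    (hmeas : ∀ t, Measurable (Z t)) (hcont : ∀ ω, Continuous (Z · ω)) :
    Tendsto (fun l : ℕ => cov[mollifiedSILT Z l, mollifiedSILT Z k; P]) atTop
      (𝓝 (∫ pq, (1 / (2 * π) ^ 2 *
        (incrCov pq.1.1.toNNReal pq.1.2.toNNReal pq.2.1.toNNReal pq.2.2.toNNReal ^ 2 /
          (|((pq.1.2.toNNReal : ℝ≥0) : ℝ) - pq.1.1.toNNReal| * (|((pq.2.2.toNNReal : ℝ≥0) : ℝ) - pq.2.1.toNNReal| + 1 / k) *
            (|((pq.1.2.toNNReal : ℝ≥0) : ℝ) - pq.1.1.toNNReal| * (|((pq.2.2.toNNReal : ℝ≥0) : ℝ) - pq.2.1.toNNReal| + 1 / k) -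
              incrCov pq.1.1.toNNReal pq.1.2.toNNReal pq.2.1.toNNReal pq.2.2.toNNReal ^ 2)))) ∂(unitSq.prod unitSq))) := by
  simp_rw [covariance_mollifiedSILT hZ hmeas hcont]
  exact tendsto_integral_covDensity_left hk

omit pq in
/-- **`E[γ (T_k - E T_k)] = ∫_{[0,1]⁴} Φ_{∞,k}` for the renormalised self-intersection local
time**: if the centred `T_l - E T_l` converge in `L²(P)` to `γ`, then (the centred `T_k` being
bounded) `E[γ T̄_k] = lim_l E[T̄_l T̄_k] = lim_l Cov(T_l, T_k)`. The target of the second-moment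
limit (α₂) behind `Stoll1989_invariance_of_secondMomentLimits`, explicitly.
[cite: LeGall1985, §2] -/
theorem integral_mul_renormalisedSILT_eq {Ω : Type*} [MeasurableSpace Ω] {P : Measure Ω}
    [IsProbabilityMeasure P] {Z : ℝ≥0 → Ω → ℂ} (hZ : IsBrownianComplex Z P)
    (hmeas : ∀ t, Measurable (Z t)) (hcont : ∀ ω, Continuous (Z · ω)) (γ : Ω → ℝ) (hγ : MemLp γ 2 P)
    (hlim : Tendsto (fun l : ℕ => eLpNorm (fun ω =>
      (mollifiedSILT Z l ω - ∫ ω', mollifiedSILT Z l ω' ∂P) - γ ω) 2 P) atTop (𝓝 0)) :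
    ∫ ω, γ ω * (mollifiedSILT Z k ω - ∫ ω', mollifiedSILT Z k ω' ∂P) ∂P =
      ∫ pq, (1 / (2 * π) ^ 2 *
        (incrCov pq.1.1.toNNReal pq.1.2.toNNReal pq.2.1.toNNReal pq.2.2.toNNReal ^ 2 /
          (|((pq.1.2.toNNReal : ℝ≥0) : ℝ) - pq.1.1.toNNReal| * (|((pq.2.2.toNNReal : ℝ≥0) : ℝ) - pq.2.1.toNNReal| + 1 / k) *
            (|((pq.1.2.toNNReal : ℝ≥0) : ℝ) - pq.1.1.toNNReal| * (|((pq.2.2.toNNReal : ℝ≥0) : ℝ) - pq.2.1.toNNReal| + 1 / k) -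
              incrCov pq.1.1.toNNReal pq.1.2.toNNReal pq.2.1.toNNReal pq.2.2.toNNReal ^ 2)))) ∂(unitSq.prod unitSq) := by
  set T : ℕ → Ω → ℝ := fun l ω => mollifiedSILT Z l ω - ∫ ω', mollifiedSILT Z l ω' ∂P with hT
  have hTmem : ∀ l, MemLp (T l) 2 P := fun l => memLp_centred hmeas hcont l
  -- `Cov(T_l, T_k) = E[T̄_l T̄_k]`
  have hcov : ∀ l, cov[mollifiedSILT Z l, mollifiedSILT Z k; P] = ∫ ω, T l ω * T k ω ∂P := fun l => rfl
  -- `T̄_k` is bounded by `k/π`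
  have hTk_bdd : ∀ ω, |T k ω| ≤ 2 * (k / (2 * π)) := by
    intro ω
    have h1 : |mollifiedSILT Z k ω| ≤ k / (2 * π) := by
      have := norm_mollifiedSILT_le hcont k ω
      rwa [Real.norm_eq_abs] at this
    have h2 : |∫ ω', mollifiedSILT Z k ω' ∂P| ≤ k / (2 * π) := by
      have := norm_integral_le_of_norm_le_const (C := (k : ℝ) / (2 * π)) (μ := P)
        (f := fun ω' => mollifiedSILT Z k ω') (ae_of_all _ fun ω' => norm_mollifiedSILT_le hcont k ω')
      simpa [probReal_univ] using this
    calc |T k ω| ≤ |mollifiedSILT Z k ω| + |∫ ω', mollifiedSILT Z k ω' ∂P| := abs_sub _ _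
      _ ≤ _ := by linarith
  -- `E[T̄_l T̄_k] → E[γ T̄_k]`
  have h2 : Tendsto (fun l : ℕ => ∫ ω, T l ω * T k ω ∂P) atTop (𝓝 (∫ ω, γ ω * T k ω ∂P)) := by
    rw [Metric.tendsto_atTop]
    intro ε hε
    have hKpos : 0 < 2 * ((k : ℝ) / (2 * π)) + 1 := by positivity
    have hε' : (0 : ℝ≥0∞) < ENNReal.ofReal (ε / (2 * (k / (2 * π)) + 1)) :=
      ENNReal.ofReal_pos.2 (div_pos hε hKpos)
    obtain ⟨N, hN⟩ := (ENNReal.tendsto_atTop_zero.1 hlim) _ hε'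
    refine ⟨N, fun l hl => ?_⟩
    have hdiff : MemLp (fun ω => T l ω - γ ω) 2 P := (hTmem l).sub hγ
    have hint_l : Integrable (fun ω => T l ω * T k ω) P := ((hTmem l).integrable_mul (hTmem k))
    have hint_γ : Integrable (fun ω => γ ω * T k ω) P := (hγ.integrable_mul (hTmem k))
    rw [Real.dist_eq, ← integral_sub hint_l hint_γ]
    have hpt : ∀ ω, T l ω * T k ω - γ ω * T k ω = (T l ω - γ ω) * T k ω := fun ω => by ring
    simp_rw [hpt]
    -- `|E[(T̄_l - γ) T̄_k]| ≤ (k/π) E|T̄_l - γ| ≤ (k/π) ‖T̄_l - γ‖₂`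
    have hL1 : Integrable (fun ω => T l ω - γ ω) P := hdiff.integrable one_le_two
    have hstep1 : |∫ ω, (T l ω - γ ω) * T k ω ∂P| ≤ 2 * (k / (2 * π)) * ∫ ω, |T l ω - γ ω| ∂P := by
      rw [← integral_const_mul]
      refine (abs_integral_le_integral_abs).trans (integral_mono_of_nonneg (ae_of_all _ fun ω => abs_nonneg _)
        (hL1.abs.const_mul _) (ae_of_all _ fun ω => ?_))
      change |(T l ω - γ ω) * T k ω| ≤ 2 * (k / (2 * π)) * |T l ω - γ ω|
      rw [abs_mul, mul_comm (2 * ((k : ℝ) / (2 * π)))]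
      exact mul_le_mul_of_nonneg_left (hTk_bdd ω) (abs_nonneg _)
    have hstep2 : ∫ ω, |T l ω - γ ω| ∂P ≤ (eLpNorm (fun ω => T l ω - γ ω) 2 P).toReal := by
      have h1 : ∫ ω, |T l ω - γ ω| ∂P = (eLpNorm (fun ω => T l ω - γ ω) 1 P).toReal := by
        rw [(hdiff.mono_exponent one_le_two).eLpNorm_eq_integral_rpow_norm one_ne_zero ENNReal.one_ne_top,
          ENNReal.toReal_ofReal (by positivity)]
        simp [Real.norm_eq_abs]
      rw [h1]
      refine ENNReal.toReal_mono hdiff.eLpNorm_ne_top ?_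
      exact eLpNorm_le_eLpNorm_of_exponent_le one_le_two hdiff.aestronglyMeasurable
    have hstep3 : (eLpNorm (fun ω => T l ω - γ ω) 2 P).toReal ≤ ε / (2 * (k / (2 * π)) + 1) :=
      ENNReal.toReal_le_of_le_ofReal (div_pos hε hKpos).le (hN l hl)
    have hK0 : 0 ≤ 2 * ((k : ℝ) / (2 * π)) := by positivity
    calc |∫ ω, (T l ω - γ ω) * T k ω ∂P| ≤ 2 * (k / (2 * π)) * ∫ ω, |T l ω - γ ω| ∂P := hstep1
      _ ≤ 2 * (k / (2 * π)) * (ε / (2 * (k / (2 * π)) + 1)) :=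
          mul_le_mul_of_nonneg_left (hstep2.trans hstep3) hK0
      _ < ε := by
          rw [← mul_div_assoc, div_lt_iff₀ hKpos]
          nlinarith
  -- `Cov(T_l, T_k) → ∫ Φ_{∞,k}`
  have h1 : Tendsto (fun l : ℕ => ∫ ω, T l ω * T k ω ∂P) atTop (𝓝 (∫ pq, (1 / (2 * π) ^ 2 *
        (incrCov pq.1.1.toNNReal pq.1.2.toNNReal pq.2.1.toNNReal pq.2.2.toNNReal ^ 2 /
          (|((pq.1.2.toNNReal : ℝ≥0) : ℝ) - pq.1.1.toNNReal| * (|((pq.2.2.toNNReal : ℝ≥0) : ℝ) - pq.2.1.toNNReal| + 1 / k) *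
            (|((pq.1.2.toNNReal : ℝ≥0) : ℝ) - pq.1.1.toNNReal| * (|((pq.2.2.toNNReal : ℝ≥0) : ℝ) - pq.2.1.toNNReal| + 1 / k) -
              incrCov pq.1.1.toNNReal pq.1.2.toNNReal pq.2.1.toNNReal pq.2.2.toNNReal ^ 2)))) ∂(unitSq.prod unitSq))) := by
    simpa only [hcov] using tendsto_covariance_mollifiedSILT_left hk hZ hmeas hcont
  exact tendsto_nhds_unique h2 h1

end Edwards2D

end Literature.Barriers.CriticalPhenomena

end
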